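import Literature.MathematicalPhysics.KineticTheory.SiteChainLyapunovDrift
import Literature.MathematicalPhysics.KineticTheory.SiteChainFokkerPlanckCutoff
import Mathlib.Analysis.ODE.Gronwall
import HarnessLib

/-!
# CEHR 2018 eq. (3.4) for site-inhomogeneous Langevin chains: `P_t e^{θH} ≤ e^{θγ(T_L+T_R)t} e^{θH}`

Topic `Literature/MathematicalPhysics/KineticTheory`, grouping namespace `…KineticTheory.HeatConduction`.
Twin, for the site-dependent chains `SiteChain` (`CellChain.lean`) with uniformly confining potentials
(`SiteChain.UniformlyConfining`) and their Langevin kernels `SiteChain.langevinKernel`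
(`SiteChainLangevinKernel.lean`), of `LangevinChainExpBound.lean` (the same bound for the homogeneous
`OscillatorChain` and the interface `LangevinChainSemigroup`). Cuneo–Eckmann–Hairer–Rey-Bellet,
*Non-equilibrium steady states for networks of oscillators*, EJP **23** (2018) no. 55, §3:
"for all `0 < θ < 1/T_max` … (3.3) `L e^{θH} = ∑_{b∈B} θγ_b ([θT_b - 1] p_b² + T_b) e^{θH} ≤ C_* e^{θH}`
… and for all `t ≥ 0` we have (3.4) `P^t V ≤ e^{C_* t} V`", `V = e^{θH}`, `C_* = θ ∑_b γ_b T_b`.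

* `MarkovSemigroupFor.act_le_exp_mul_of_generator_le` — the GENERIC Grönwall step along a Markov
  semigroup: `L g ≤ K g` (`g ≥ 0` bounded continuous, `L g` bounded continuous, `K ≥ 0`) and
  Dynkin's identity for `g` give `P_t g(z) ≤ e^{Kt} g(z)`;
* `SiteChain.generator_comp_hamiltonian_le` — (3.3) for `F∘H`: `L(F∘H) ≤ θγ(T_L+T_R) F(H)` when
  `0 ≤ F'(H) ≤ θF(H)`, `F''(H) ≤ θF'(H)`, `θT_L, θT_R ≤ 1`;
* `MarkovSemigroupFor.siteChain_integral_expCutoff_hamiltonian_le`,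
  `MarkovSemigroupFor.siteChain_lintegral_exp_mul_hamiltonian_le` — the truncated bound for the smooth
  truncated exponentials `expCutoff θ R` and (3.4) by Fatou, for every
  `S : MarkovSemigroupFor (P.generator N T_L T_R)` with Dynkin on `C²_c`;
* `SiteChain.UniformlyConfining.lintegral_exp_mul_hamiltonian_langevinKernel_le(_of_lt)` — (3.4) for
  the constructed kernels `P.langevinKernel N T_L T_R` (`N ≥ 1`; `0 ≤ θ`, `θT_b ≤ 1`, resp.
  `T_L, T_R > 0`, `0 < θ < 1/max(T_L,T_R)`).

## References

* N. Cuneo, J.-P. Eckmann, M. Hairer, L. Rey-Bellet, EJP **23** (2018) no. 55, §3 eqs. (3.3)–(3.4).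
* R. Khasminskii, *Stochastic Stability of Differential Equations* (2nd ed., 2012), Thm 3.5
  (`E V(X_t) ≤ e^{ct} V(x)` from `LV ≤ cV`).

## Design choices

* The Dynkin + Grönwall argument of `LangevinChainExpBound.lean` is factored through the generic
  `MarkovSemigroupFor.act_le_exp_mul_of_generator_le` (any state space, any generator symbol `L`).
* The chain calculus is `SiteChain.generator_comp_hamiltonian` (`SiteChainFokkerPlanckCutoff.lean`, in
  `sdeGenerator` form) and `sdeGenerator_langevinDrift_eq_generator`; the cutoffs are the `expCutoff θ R`
  of `LangevinChainExpBound.lean`.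
-/

noncomputable section

open MeasureTheory ProbabilityTheory Filter Topology Set intervalIntegral
open scoped NNReal ENNReal

namespace Literature.MathematicalPhysics.KineticTheory.HeatConduction

open Literature.MathematicalPhysics.KineticTheory Literature.Probability.Process

variable {N : ℕ}

/-! ### A Grönwall step along a Markov semigroup -/

namespace MarkovSemigroupFor

section Generic

variable {X : Type*} [MeasurableSpace X] [NormedAddCommGroup X] [NormedSpace ℝ X]
  [OpensMeasurableSpace X] {L : (X → ℝ) → X → ℝ} (S : MarkovSemigroupFor L)

/-- **Grönwall along a Markov semigroup.** If `g ≥ 0` is bounded continuous, `L g` is bounded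
continuous with `L g ≤ K g` pointwise (`K ≥ 0`), and Dynkin's identity
`P_t g(z) - g(z) = ∫₀ᵗ P_s(Lg)(z) ds` holds at `z`, then `P_t g(z) ≤ e^{Kt} g(z)`: with
`φ(s) = P_s g(z)`, `Φ = ∫₀ φ`, one has `Φ' = φ ≤ g(z) + KΦ`, and Grönwall's inequality
(`norm_le_gronwallBound_of_norm_deriv_right_le`) bounds `Φ`, hence `φ`. [folklore] -/
theorem act_le_exp_mul_of_generator_le {g : X → ℝ} (hg : Continuous g) (hg0 : ∀ y, 0 ≤ g y)
    {B : ℝ} (hgB : ∀ y, ‖g y‖ ≤ B) (hLg : Continuous (L g)) {C : ℝ} (hC : ∀ y, ‖L g y‖ ≤ C)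
    {K : ℝ} (hK : 0 ≤ K) (hle : ∀ y, L g y ≤ K * g y) (z : X)
    (hdyn : ∀ t : ℝ≥0, S.act t g z - g z = ∫ s in (0 : ℝ)..(t : ℝ), S.act s.toNNReal (L g) z)
    (t : ℝ≥0) : S.act t g z ≤ Real.exp (K * t) * g z := by
  -- the orbit maps `φ(s) = P_s g (z)`, `ψ(s) = P_s (L g)(z)` (`s ≤ 0` read as `s = 0`)
  set φ : ℝ → ℝ := fun s => ∫ y, g y ∂(S.kernel s.toNNReal z) with hφdef
  set ψ : ℝ → ℝ := fun s => ∫ y, L g y ∂(S.kernel s.toNNReal z) with hψdef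
  have hφ_meas : StronglyMeasurable φ :=
    (S.stronglyMeasurable_uncurry_act hg.stronglyMeasurable).comp_measurable
      (measurable_const.prodMk measurable_id)
  have hψ_meas : StronglyMeasurable ψ :=
    (S.stronglyMeasurable_uncurry_act hLg.stronglyMeasurable).comp_measurable
      (measurable_const.prodMk measurable_id)
  have hφ_bound : ∀ s, ‖φ s‖ ≤ B := fun s => S.norm_act_le _ hgB z
  have hψ_bound : ∀ s, ‖ψ s‖ ≤ C := fun s => S.norm_act_le _ hC z
  have hφ_nonneg : ∀ s, 0 ≤ φ s := fun s => integral_nonneg hg0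
  have hφ_int : ∀ a b, IntervalIntegrable φ volume a b :=
    intervalIntegrable_of_norm_le hφ_meas hφ_bound
  have hψ_int : ∀ a b, IntervalIntegrable ψ volume a b :=
    intervalIntegrable_of_norm_le hψ_meas hψ_bound
  have hψ_le : ∀ s, ψ s ≤ K * φ s := fun s => by
    calc ψ s ≤ ∫ y, K * g y ∂(S.kernel s.toNNReal z) :=
          integral_mono (S.integrable_kernel_of_norm_le _ z hLg hC)
            ((S.integrable_kernel_of_norm_le _ z hg hgB).const_mul K) hle
      _ = K * φ s := integral_const_mul K g
  -- Dynkin's identity: `φ(s) = g(z) + ∫₀ˢ ψ` for `s ≥ 0`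
  have hdyn' : ∀ s : ℝ, 0 ≤ s → φ s = g z + ∫ r in (0 : ℝ)..s, ψ r := by
    intro s hs
    have h := hdyn s.toNNReal
    simp only [act_apply, Real.coe_toNNReal _ hs] at h
    change φ s - g z = ∫ r in (0 : ℝ)..s, ψ r at h
    linarith
  have hφ_eq : φ = fun s => g z + ∫ r in (0 : ℝ)..(max s 0), ψ r := by
    funext s
    rcases le_total 0 s with hs | hs
    · rw [max_eq_left hs]; exact hdyn' s hs
    · rw [max_eq_right hs, intervalIntegral.integral_same, add_zero]
      change ∫ y, g y ∂(S.kernel s.toNNReal z) = g z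
      rw [Real.toNNReal_of_nonpos hs, kernel_zero_apply, integral_dirac' _ _ hg.stronglyMeasurable]
  have hφ_cont : Continuous φ := by
    rw [hφ_eq]
    exact continuous_const.add
      ((intervalIntegral.continuous_primitive hψ_int 0).comp (continuous_id.max continuous_const))
  -- Grönwall for `Φ(s) = ∫₀ˢ φ`: `Φ' = φ ≤ g z + K Φ`
  set Φ : ℝ → ℝ := fun s => ∫ r in (0 : ℝ)..s, φ r with hΦdef
  have hΦ_deriv : ∀ s, HasDerivAt Φ (φ s) s := fun s =>
    (hφ_cont.integral_hasStrictDerivAt 0 s).hasDerivAt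
  have hΦ_nonneg : ∀ s, 0 ≤ s → 0 ≤ Φ s := fun s hs =>
    intervalIntegral.integral_nonneg hs fun r _ => hφ_nonneg r
  have hφ_le : ∀ s, 0 ≤ s → φ s ≤ g z + K * Φ s := by
    intro s hs
    rw [hdyn' s hs]
    have h1 : ∫ r in (0 : ℝ)..s, ψ r ≤ ∫ r in (0 : ℝ)..s, K * φ r :=
      intervalIntegral.integral_mono_on hs (hψ_int 0 s) ((hφ_int 0 s).const_mul K)
        fun r _ => hψ_le r
    rw [intervalIntegral.integral_const_mul] at h1
    linarith
  have hG : ∀ x ∈ Icc (0 : ℝ) t, ‖Φ x‖ ≤ gronwallBound 0 K (g z) (x - 0) := by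
    refine norm_le_gronwallBound_of_norm_deriv_right_le (f' := φ)
      (fun x _ => (hΦ_deriv x).continuousAt.continuousWithinAt)
      (fun x _ => (hΦ_deriv x).hasDerivWithinAt) (by simp [hΦdef]) fun x hx => ?_
    rw [Real.norm_of_nonneg (hφ_nonneg x), Real.norm_of_nonneg (hΦ_nonneg x hx.1)]
    linarith [hφ_le x hx.1]
  have ht0 : (0 : ℝ) ≤ t := t.coe_nonneg
  have hGt := hG t ⟨ht0, le_rfl⟩
  rw [sub_zero, Real.norm_of_nonneg (hΦ_nonneg t ht0)] at hGt
  -- conclusion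
  have hφt : φ t = S.act t g z := by
    simp only [hφdef, Real.toNNReal_coe, act_apply]
  rw [← hφt]
  rcases hK.eq_or_lt with hK' | hK'
  · -- `K = 0`
    have := hφ_le t ht0
    rw [← hK'] at this ⊢
    simpa using this
  · have hne : K ≠ 0 := hK'.ne'
    rw [gronwallBound_of_K_ne_0 hne] at hGt
    simp only [zero_mul, zero_add] at hGt
    have h1 := hφ_le t ht0
    have h2 : K * Φ t ≤ g z * (Real.exp (K * t) - 1) := by
      calc K * Φ t ≤ K * (g z / K * (Real.exp (K * t) - 1)) := mul_le_mul_of_nonneg_left hGt hK'.le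
        _ = g z * (Real.exp (K * t) - 1) := by field_simp
    calc φ t ≤ g z + K * Φ t := h1
      _ ≤ g z + g z * (Real.exp (K * t) - 1) := by linarith
      _ = Real.exp (K * t) * g z := by ring

end Generic

end MarkovSemigroupFor

/-! ### (3.3) for a function of the energy of a site-dependent chain -/

/-- The elementary inequality behind CEHR (3.3): for `A, B, T_L, T_R ≥ 0`, `θT_L, θT_R ≤ 1`,
`0 ≤ b ≤ θa` and `c ≤ θb`,
`b (T_L + T_R - A - B) + c (T_L A + T_R B) ≤ θ a (T_L + T_R)`
(`= b(T_L+T_R) - bA(1-θT_L) - bB(1-θT_R) + (c - θb)(T_L A + T_R B)`). [folklore] -/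
theorem bath_terms_comp_le {a b c A B T_L T_R θ : ℝ} (hA : 0 ≤ A) (hB : 0 ≤ B) (hTL : 0 ≤ T_L)
    (hTR : 0 ≤ T_R) (hL : θ * T_L ≤ 1) (hR : θ * T_R ≤ 1) (h1 : 0 ≤ b) (h2 : b ≤ θ * a)
    (h3 : c ≤ θ * b) :
    b * (T_L + T_R - A - B) + c * (T_L * A + T_R * B) ≤ θ * a * (T_L + T_R) := by
  have hAB : 0 ≤ T_L * A + T_R * B := by positivity
  have e1 : c * (T_L * A + T_R * B) ≤ θ * b * (T_L * A + T_R * B) :=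
    mul_le_mul_of_nonneg_right h3 hAB
  have e2 : b * (T_L + T_R - A - B) + θ * b * (T_L * A + T_R * B) ≤ b * (T_L + T_R) := by
    have : b * (T_L + T_R - A - B) + θ * b * (T_L * A + T_R * B) =
        b * (T_L + T_R) - (b * A * (1 - θ * T_L) + b * B * (1 - θ * T_R)) := by ring
    rw [this]
    have h4 : 0 ≤ b * A * (1 - θ * T_L) := mul_nonneg (mul_nonneg h1 hA) (sub_nonneg.2 hL)
    have h5 : 0 ≤ b * B * (1 - θ * T_R) := mul_nonneg (mul_nonneg h1 hB) (sub_nonneg.2 hR)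
    linarith
  have hT : 0 ≤ T_L + T_R := add_nonneg hTL hTR
  have e3 : b * (T_L + T_R) ≤ θ * a * (T_L + T_R) := mul_le_mul_of_nonneg_right h2 hT
  linarith

namespace SiteChain

variable (P : SiteChain)

/-- **`L(F∘H) ≤ θγ(T_L + T_R) F(H)` for a site-dependent chain** (`C²` potentials, `N ≥ 1`,
`γ, T_L, T_R ≥ 0`, `θT_L, θT_R ≤ 1`), whenever `0 ≤ F'(H) ≤ θ F(H)` and `F''(H) ≤ θ F'(H)` at the
point; `L = sdeGenerator Y v_L v_R` (`= P.generator N T_L T_R` on `C²`,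
`sdeGenerator_langevinDrift_eq_generator`). By `generator_comp_hamiltonian`,
`L(F∘H) = γ [F'(H)(T_L + T_R - p_0² - p_{N-1}²) + F''(H)(T_L p_0² + T_R p_{N-1}²)]`, and each bath
contributes at most `γ T_b F'(H) ≤ θγ T_b F(H)`. For `F = e^{θ·}` this is CEHR (3.3)
`L e^{θH} ≤ C_* e^{θH}`. [cite: CuneoEckmannHairerReyBellet2018, §3 eq. (3.3)] -/
theorem generator_comp_hamiltonian_le (hU : ∀ i, ContDiff ℝ 2 (P.U i))
    (hV : ∀ i, ContDiff ℝ 2 (P.V i)) (hN : 0 < N) (hγ : 0 ≤ P.γ) {T_L T_R θ : ℝ} (hTL : 0 ≤ T_L)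
    (hTR : 0 ≤ T_R) (hL : θ * T_L ≤ 1) (hR : θ * T_R ≤ 1) {F F' F'' : ℝ → ℝ}
    (hF : ∀ u, HasDerivAt F (F' u) u) (hF' : ∀ u, HasDerivAt F' (F'' u) u) (x : PhaseSpace N)
    (h1 : 0 ≤ F' (P.hamiltonian N x)) (h2 : F' (P.hamiltonian N x) ≤ θ * F (P.hamiltonian N x))
    (h3 : F'' (P.hamiltonian N x) ≤ θ * F' (P.hamiltonian N x)) :
    sdeGenerator (P.langevinDrift N) (P.noiseVecL N T_L) (P.noiseVecR N T_R)
        (fun y => F (P.hamiltonian N y)) x ≤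
      θ * P.γ * (T_L + T_R) * F (P.hamiltonian N x) := by
  rw [P.generator_comp_hamiltonian hU hV hN (mul_nonneg hγ hTL) (mul_nonneg hγ hTR) hF hF' x]
  have key := bath_terms_comp_le (sq_nonneg (x.2 ⟨0, hN⟩))
    (sq_nonneg (x.2 ⟨N - 1, Nat.sub_lt hN one_pos⟩)) hTL hTR hL hR h1 h2 h3
  calc _ ≤ P.γ * (θ * F (P.hamiltonian N x) * (T_L + T_R)) := mul_le_mul_of_nonneg_left key hγ
    _ = θ * P.γ * (T_L + T_R) * F (P.hamiltonian N x) := by ring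

end SiteChain

/-! ### (3.4) for every `MarkovSemigroupFor (P.generator N T_L T_R)` with Dynkin on `C²_c` -/

namespace MarkovSemigroupFor

variable {P : SiteChain} {T_L T_R : ℝ} (S : MarkovSemigroupFor (P.generator N T_L T_R))

/-- **The truncated bound** for a uniformly confining site chain (`N ≥ 1`, `T_L, T_R ≥ 0`), a
Markov semigroup `S` for `P.generator N T_L T_R` with Dynkin's identity on `C²_c`, `0 ≤ θ`,
`θT_L, θT_R ≤ 1` and `R > 0`: `P_t (F_R∘H)(z) ≤ e^{θγ(T_L+T_R)t} F_R(H(z))` for the truncated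
exponentials `F_R = expCutoff θ R` — Dynkin for `F_R∘H - F_R(2R) ∈ C²_c`, `L(F_R∘H) ≤ C_* F_R∘H`
(`SiteChain.generator_comp_hamiltonian_le`), and the Grönwall step
`act_le_exp_mul_of_generator_le`. [cite: CuneoEckmannHairerReyBellet2018, §3 eq. (3.4)] -/
theorem siteChain_integral_expCutoff_hamiltonian_le (hP : P.UniformlyConfining) (hN : 0 < N)
    (hTL : 0 ≤ T_L) (hTR : 0 ≤ T_R)
    (hdyn : ∀ f : PhaseSpace N → ℝ, ContDiff ℝ 2 f → HasCompactSupport f →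
      ∀ (t : ℝ≥0) (z : PhaseSpace N), S.act t f z - f z =
        ∫ s in (0 : ℝ)..(t : ℝ), S.act s.toNNReal (P.generator N T_L T_R f) z)
    {θ : ℝ} (hθ : 0 ≤ θ) (hL : θ * T_L ≤ 1) (hR : θ * T_R ≤ 1) {R : ℝ} (hR0 : 0 < R)
    (t : ℝ≥0) (z : PhaseSpace N) :
    ∫ y, expCutoff θ R (P.hamiltonian N y) ∂(S.kernel t z) ≤
      Real.exp (θ * P.γ * (T_L + T_R) * t) * expCutoff θ R (P.hamiltonian N z) := by
  have hγ : 0 ≤ P.γ := hP.γ_nonneg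
  have hL' : 0 ≤ P.γ * T_L := mul_nonneg hγ hTL
  have hR' : 0 ≤ P.γ * T_R := mul_nonneg hγ hTR
  -- the truncated Lyapunov function `g = F_R∘H`, its compactly supported shift `u = g - F_R(2R)`
  set H := P.hamiltonian N with hHdef
  set g : PhaseSpace N → ℝ := fun y => expCutoff θ R (H y) with hgdef
  set c : ℝ := expCutoff θ R (2 * R) with hcdef
  set u : PhaseSpace N → ℝ := fun y => g y - c with hudef
  set K : ℝ := θ * P.γ * (T_L + T_R) with hKdef
  have hH2 : ContDiff ℝ 2 H := hP.contDiff_hamiltonian N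
  have hF2 : ContDiff ℝ 2 (expCutoff θ R) := (contDiff_expCutoff θ R).of_le (by norm_cast)
  have hg2 : ContDiff ℝ 2 g := hF2.comp hH2
  have hu2 : ContDiff ℝ 2 u := hg2.sub contDiff_const
  have hu_supp : HasCompactSupport u := by
    refine HasCompactSupport.intro (hP.isCompact_setOf_hamiltonian_le N (2 * R)) fun x hx => ?_
    simp only [mem_setOf_eq, not_le] at hx
    show expCutoff θ R (H x) - c = 0
    rw [expCutoff_of_ge hR0 hx.le, sub_self]
  have hg_nonneg : ∀ y, 0 ≤ g y := fun y => (expCutoff_pos hθ hR0 _).le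
  have hg_norm : ∀ y, ‖g y‖ ≤ Real.exp (θ * (2 * R)) := fun y => by
    rw [Real.norm_of_nonneg (hg_nonneg y)]; exact expCutoff_le_exp_two_mul hθ hR0 _
  have hg_cont : Continuous g := hg2.continuous
  -- `L g = L u` is bounded and continuous, and `L g ≤ K g`
  have hLu : P.generator N T_L T_R u = P.generator N T_L T_R g := by
    have hQ : ∀ i : Fin N, partialQ i (fun y => g y - c) = partialQ i g := fun i => by
      funext x; unfold partialQ; exact deriv_sub_const _
    have hPp : ∀ (i : Fin N) (g' : PhaseSpace N → ℝ),
        partialP i (fun y => g' y - c) = partialP i g' := fun i g' => by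
      funext x; unfold partialP; exact deriv_sub_const _
    funext x
    simp only [SiteChain.generator, hudef, hQ, hPp]
  have hLg_cont : Continuous (P.generator N T_L T_R g) := hP.continuous_generator N T_L T_R hg2
  obtain ⟨CL, hCL⟩ : ∃ CL, ∀ x, ‖P.generator N T_L T_R g x‖ ≤ CL := by
    obtain ⟨CL, hCL⟩ := hP.exists_bound_generator N T_L T_R hu2 hu_supp
    exact ⟨CL, fun x => by rw [← hLu]; exact hCL x⟩
  have hLg_le : ∀ x, P.generator N T_L T_R g x ≤ K * g x := fun x => by
    rw [← P.sdeGenerator_langevinDrift_eq_generator hN hL' hR' hg2]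
    exact P.generator_comp_hamiltonian_le hP.contDiff_U hP.contDiff_V hN hγ hTL hTR hL hR
      (hasDerivAt_expCutoff θ R)
      (fun v => ((hasDerivAt_expCutoffDeriv θ R v).differentiableAt).hasDerivAt) x
      (expCutoffDeriv_nonneg hθ _) (expCutoffDeriv_le hθ hR0 _) (deriv_expCutoffDeriv_le hθ hR0 _)
  have hK0 : 0 ≤ K := by
    have : 0 ≤ T_L + T_R := add_nonneg hTL hTR
    positivity
  -- Dynkin's identity for `u`, rewritten for `g`
  have hdyn_g : ∀ s : ℝ≥0, S.act s g z - g z =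
      ∫ r in (0 : ℝ)..(s : ℝ), S.act r.toNNReal (P.generator N T_L T_R g) z := by
    intro s
    have h := hdyn u hu2 hu_supp s z
    rw [hLu] at h
    have hint : S.act s u z = S.act s g z - c := by
      show ∫ y, (g y - c) ∂(S.kernel s z) = (∫ y, g y ∂(S.kernel s z)) - c
      rw [integral_sub (S.integrable_kernel_of_norm_le _ z hg_cont hg_norm) (integrable_const c)]
      simp
    rw [hint] at h
    have hu0 : u z = g z - c := rfl
    rw [hu0] at h
    linarith
  have h := S.act_le_exp_mul_of_generator_le hg_cont hg_nonneg hg_norm hLg_cont hCL hK0 hLg_le z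
    hdyn_g t
  simpa only [act_apply] using h

/-- **Cuneo–Eckmann–Hairer–Rey-Bellet 2018, eq. (3.4) `P^t e^{θH} ≤ e^{C_* t} e^{θH}` for a
uniformly confining site chain**, for every Markov semigroup `S` for `P.generator N T_L T_R` with
Dynkin's identity on `C²_c` (`N ≥ 1`, `T_L, T_R ≥ 0`, `0 ≤ θ`, `θT_L, θT_R ≤ 1`):
`∫ e^{θH(y)} P_t(z, dy) ≤ e^{θγ(T_L+T_R)t} e^{θH(z)}` (Lebesgue integral; `C_* = θγ(T_L + T_R)`). From
the truncated bound by Fatou's lemma (`F_{n+1}∘H → e^{θH}`).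
[cite: CuneoEckmannHairerReyBellet2018, §3 eq. (3.4)] -/
theorem siteChain_lintegral_exp_mul_hamiltonian_le (hP : P.UniformlyConfining) (hN : 0 < N)
    (hTL : 0 ≤ T_L) (hTR : 0 ≤ T_R)
    (hdyn : ∀ f : PhaseSpace N → ℝ, ContDiff ℝ 2 f → HasCompactSupport f →
      ∀ (t : ℝ≥0) (z : PhaseSpace N), S.act t f z - f z =
        ∫ s in (0 : ℝ)..(t : ℝ), S.act s.toNNReal (P.generator N T_L T_R f) z)
    {θ : ℝ} (hθ : 0 ≤ θ) (hL : θ * T_L ≤ 1) (hR : θ * T_R ≤ 1) (t : ℝ≥0) (z : PhaseSpace N) :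
    ∫⁻ y, ENNReal.ofReal (Real.exp (θ * P.hamiltonian N y)) ∂(S.kernel t z) ≤
      ENNReal.ofReal (Real.exp (θ * P.γ * (T_L + T_R) * t) *
        Real.exp (θ * P.hamiltonian N z)) := by
  have hHc : Continuous (P.hamiltonian N) := (hP.contDiff_hamiltonian N).continuous
  set f : ℕ → PhaseSpace N → ℝ≥0∞ := fun n y =>
    ENNReal.ofReal (expCutoff θ (n + 1) (P.hamiltonian N y)) with hfdef
  have hf_meas : ∀ n, Measurable (f n) := fun n =>
    ENNReal.measurable_ofReal.comp ((continuous_expCutoff _ _).comp hHc).measurable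
  have hf_tendsto : ∀ y, Tendsto (fun n => f n y) atTop
      (𝓝 (ENNReal.ofReal (Real.exp (θ * P.hamiltonian N y)))) := fun y =>
    (ENNReal.continuous_ofReal.tendsto _).comp (tendsto_expCutoff_atTop θ _)
  calc ∫⁻ y, ENNReal.ofReal (Real.exp (θ * P.hamiltonian N y)) ∂(S.kernel t z)
      = ∫⁻ y, liminf (fun n => f n y) atTop ∂(S.kernel t z) :=
        lintegral_congr fun y => ((hf_tendsto y).liminf_eq).symm
    _ ≤ liminf (fun n => ∫⁻ y, f n y ∂(S.kernel t z)) atTop := lintegral_liminf_le hf_meas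
    _ ≤ ENNReal.ofReal (Real.exp (θ * P.γ * (T_L + T_R) * t) *
          Real.exp (θ * P.hamiltonian N z)) := by
        refine liminf_le_of_frequently_le' (Eventually.of_forall fun n => ?_).frequently
        have hR0 : (0 : ℝ) < n + 1 := by positivity
        have hint : Integrable (fun y => expCutoff θ (n + 1) (P.hamiltonian N y)) (S.kernel t z) :=
          S.integrable_kernel_of_norm_le t z ((continuous_expCutoff _ _).comp hHc) fun y => by
            rw [Real.norm_of_nonneg (expCutoff_pos hθ hR0 _).le]
            exact expCutoff_le_exp_two_mul hθ hR0 _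
        simp only [hfdef]
        rw [← ofReal_integral_eq_lintegral_ofReal hint
          (Eventually.of_forall fun y => (expCutoff_pos hθ hR0 _).le)]
        refine ENNReal.ofReal_le_ofReal ?_
        exact (S.siteChain_integral_expCutoff_hamiltonian_le hP hN hTL hTR hdyn hθ hL hR hR0 t
          z).trans (mul_le_mul_of_nonneg_left (expCutoff_le_exp hθ hR0 _) (Real.exp_pos _).le)

end MarkovSemigroupFor

/-! ### (3.4) for the constructed Langevin kernels -/

namespace SiteChain.UniformlyConfining

variable {P : SiteChain} {T_L T_R : ℝ}

/-- **(3.4) for the Langevin kernels of a uniformly confining site chain**: for `N ≥ 1`,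
`T_L, T_R ≥ 0`, `0 ≤ θ` with `θT_L, θT_R ≤ 1`,
`∫ e^{θH} dP_t(z, ·) ≤ e^{θγ(T_L+T_R)t} e^{θH(z)}` for `P_t = P.langevinKernel N T_L T_R t` (Lebesgue
integral): the semigroup `UniformlyConfining.semigroup` with its Dynkin identity on `C²_c`
(`semigroup_dynkin_two`). [cite: CuneoEckmannHairerReyBellet2018, §3 eq. (3.4)] -/
theorem lintegral_exp_mul_hamiltonian_langevinKernel_le (hP : P.UniformlyConfining) (hN : 0 < N)
    (hTL : 0 ≤ T_L) (hTR : 0 ≤ T_R) {θ : ℝ} (hθ : 0 ≤ θ) (hL : θ * T_L ≤ 1) (hR : θ * T_R ≤ 1)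
    (t : ℝ≥0) (z : PhaseSpace N) :
    ∫⁻ y, ENNReal.ofReal (Real.exp (θ * P.hamiltonian N y)) ∂(P.langevinKernel N T_L T_R t z) ≤
      ENNReal.ofReal (Real.exp (θ * P.γ * (T_L + T_R) * t) *
        Real.exp (θ * P.hamiltonian N z)) :=
  (hP.semigroup N T_L T_R hN hTL hTR).siteChain_lintegral_exp_mul_hamiltonian_le hP hN hTL hTR
    (fun _ hf hf' t z => hP.semigroup_dynkin_two N T_L T_R hN hTL hTR hf hf' t z) hθ hL hR t z

/-- **(3.4) for the Langevin kernels of a uniformly confining site chain, `0 < θ < 1/max(T_L,T_R)`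
form** (`N ≥ 1`, `T_L, T_R > 0`): `∫ e^{θH} dP_t(z, ·) ≤ e^{θγ(T_L+T_R)t} e^{θH(z)}`.
[cite: CuneoEckmannHairerReyBellet2018, §3 eq. (3.4)] -/
theorem lintegral_exp_mul_hamiltonian_langevinKernel_le_of_lt (hP : P.UniformlyConfining)
    (hN : 0 < N) (hTL : 0 < T_L) (hTR : 0 < T_R) {θ : ℝ} (hθ : 0 < θ)
    (hθ' : θ < 1 / max T_L T_R) (t : ℝ≥0) (z : PhaseSpace N) :
    ∫⁻ y, ENNReal.ofReal (Real.exp (θ * P.hamiltonian N y)) ∂(P.langevinKernel N T_L T_R t z) ≤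
      ENNReal.ofReal (Real.exp (θ * P.γ * (T_L + T_R) * t) *
        Real.exp (θ * P.hamiltonian N z)) := by
  have hm : 0 < max T_L T_R := lt_max_of_lt_left hTL
  have hθm : θ * max T_L T_R ≤ 1 := ((lt_div_iff₀ hm).1 hθ').le
  have hL : θ * T_L ≤ 1 := (mul_le_mul_of_nonneg_left (le_max_left _ _) hθ.le).trans hθm
  have hR : θ * T_R ≤ 1 := (mul_le_mul_of_nonneg_left (le_max_right _ _) hθ.le).trans hθm
  exact hP.lintegral_exp_mul_hamiltonian_langevinKernel_le hN hTL.le hTR.le hθ.le hL hR t z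

end SiteChain.UniformlyConfining

end Literature.MathematicalPhysics.KineticTheory.HeatConduction
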